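import Summits.QuantumFields.YangMills.Theorems.SoloBlindOddTorusMixed
import HarnessLib

/-!
# Solo-blind rung D8 (part 8): OS positivity for SLAB-supported observables on the odd torus

`Summit.QuantumFields.YangMills.Theorems.SoloBlindOddTorusSlabRP` (read-only conjunct `YangMills`).

Parts 1–7 treated time-zero spatial observables, on which the site reflection `Θ'` acts
trivially; this part removes that restriction.  On the odd torus `(ℤ/L)^d`, `L = 2m + 1 ≥ 3`,
for real observables supported in time slabs `[-T', T]` define the **OS pairing**
`P_{F,G}(s) := ⟨(F ∘ Θ') · G(· + s e₀)⟩_{L,β} = M_{F∘Θ', G}(s)`.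

From the link reflection positivity of Wilson's measure (tree, via part 1) and the identity
`τ_{-t} ∘ Θ_link = Θ' ∘ τ_{-(1-t)}` on configurations we prove, for `β ≥ 0`, compact `G`,
continuous `ρ`, and slices `T' + 1 ≤ t ≤ m - T`:

* `osPairing_symm` — `P_{G,F}(s) = P_{F,G}(s)` (Θ'-invariance of the measure);
* `osPairing_quadratic_nonneg`, `osPairing_schwarz` — the Gram/Schwarz inequality
  `P_{F,G}(t + t' - 1)² ≤ P_{F,F}(2t - 1) · P_{G,G}(2t' - 1)`;
* `osPairingSeq_odd_nonneg`, `osPairingSeq_odd_logConvex`, `osPairingSeq_even_sq_le` — the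
  ODD-indexed subsequence `n ↦ P_{F,F}(2n + 1)` is nonnegative and log-convex, and the even terms
  are dominated by the geometric mean of their odd neighbours, on the admissible range.

No symmetry `s ↦ -s` is available for slab observables (parts 2–7 had it in the time-zero case);
the endpoint reduction of part 9 therefore runs on the odd subsequence.  Everything here holds
for all `β ≥ 0` and every compact `G`: it organises, but does not produce, decay.
[folklore: E. Seiler, LNP 159 (1982) Ch. 2; K. Osterwalder, E. Seiler, Ann. Phys. 110 (1978) §2]
-/

open MeasureTheory
open Literature.MathematicalPhysics.QuantumFieldTheory

noncomputable section

namespace Summit.QuantumFields.YangMills.Theorems.SoloBlind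

variable {d L N : ℕ} [NeZero d] [NeZero L] {G : Type*} [Group G] [TopologicalSpace G]
  [IsTopologicalGroup G] [CompactSpace G] [MeasurableSpace G] [BorelSpace G]
  (ρ : G →* Matrix (Fin N) (Fin N) ℂ)

/-! ### Geometry: the two reflections and time translations -/

omit [NeZero L] in
/-- Site identity behind `translate_timeReflect_eq` (spatial links). -/
private theorem site_translate_timeReflect (x : Site d L) (t : ZMod L) :
    (x + Pi.single (0 : Fin d) t).timeReflect = x.negReflect + Pi.single (0 : Fin d) (1 - t) := by
  funext k
  by_cases hk : k = 0
  · subst hk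
    simp [Site.timeReflect, Site.negReflect]
    ring
  · simp [Site.timeReflect, Site.negReflect, hk]

omit [NeZero L] in
/-- Site identity behind `translate_timeReflect_eq` (temporal links). -/
private theorem site_translate_shift_timeReflect (x : Site d L) (t : ZMod L) :
    ((x + Pi.single (0 : Fin d) t).shift 0).timeReflect =
      (x.shift 0).negReflect + Pi.single (0 : Fin d) (1 - t) := by
  funext k
  by_cases hk : k = 0
  · subst hk
    simp [Site.timeReflect, Site.negReflect, Site.shift]
    ring
  · simp [Site.timeReflect, Site.negReflect, Site.shift, hk]

omit [NeZero L] in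
/-- Site identity behind `negReflect_translate_eq` (spatial links). -/
private theorem site_negReflect_translate (x : Site d L) (s : ZMod L) :
    (x + Pi.single (0 : Fin d) s).negReflect = x.negReflect - Pi.single (0 : Fin d) s := by
  funext k
  by_cases hk : k = 0
  · subst hk
    simp [Site.negReflect]
    ring
  · simp [Site.negReflect, hk]

omit [NeZero L] in
/-- Site identity behind `negReflect_translate_eq` (temporal links). -/
private theorem site_negReflect_translate_shift (x : Site d L) (s : ZMod L) :
    ((x + Pi.single (0 : Fin d) s).shift 0).negReflect =
      (x.shift 0).negReflect - Pi.single (0 : Fin d) s := by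
  funext k
  by_cases hk : k = 0
  · subst hk
    simp [Site.negReflect, Site.shift]
    ring
  · simp [Site.negReflect, Site.shift, hk]

omit [NeZero L] [TopologicalSpace G] [IsTopologicalGroup G] [CompactSpace G] [BorelSpace G] in
/-- **Link reflection after a time translation is the site reflection after the mirror
translation**: `τ_{-t}(Θ U) = Θ'(τ_{-(1-t)} U)` on configurations. [folklore] -/
theorem translate_timeReflect_eq (t : ZMod L) (U : GaugeConfig d L G) :
    torusConfigShift (-(Pi.single (0 : Fin d) t : Site d L)) U.timeReflect =
      (torusConfigShift (-(Pi.single (0 : Fin d) (1 - t) : Site d L)) U).negReflect := by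
  funext e
  obtain ⟨x, i⟩ := e
  by_cases hi : i = 0
  · subst hi
    simp [torusConfigShift_apply, GaugeConfig.timeReflect, GaugeConfig.negReflect,
      site_translate_shift_timeReflect]
  · simp [torusConfigShift_apply, GaugeConfig.timeReflect, GaugeConfig.negReflect, hi,
      site_translate_timeReflect]

omit [NeZero L] [TopologicalSpace G] [IsTopologicalGroup G] [CompactSpace G] [BorelSpace G] in
/-- The site reflection reverses time translations: `Θ'(τ_{s} U) = τ_{-s}(Θ' U)`. [folklore] -/
theorem negReflect_translate_eq (s : ZMod L) (U : GaugeConfig d L G) :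
    (torusConfigShift (Pi.single (0 : Fin d) s : Site d L) U).negReflect =
      torusConfigShift (-(Pi.single (0 : Fin d) s : Site d L)) U.negReflect := by
  funext e
  obtain ⟨x, i⟩ := e
  by_cases hi : i = 0
  · subst hi
    simp [torusConfigShift_apply, GaugeConfig.negReflect, site_negReflect_translate_shift]
  · simp [torusConfigShift_apply, GaugeConfig.negReflect, hi, site_negReflect_translate]

/-! ### Slab support -/

/-- Edges of the time slab `[-T', T]` (times read in `[0, L)`; temporal links END by time `T`). -/
def slabEdges (T' T : ℕ) : Set (Edge d L) :=
  {e | (e.1 0).val + (if e.2 = 0 then 1 else 0) ≤ T ∨ L ≤ (e.1 0).val + T'}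

omit [Group G] [TopologicalSpace G] [IsTopologicalGroup G] [CompactSpace G] [BorelSpace G] in
/-- A translate by `t` of a `[-T', T]`-slab observable lives in the positive half of the odd torus
when `T' + 1 ≤ t ≤ L/2 - T`. [folklore] -/
theorem dependsOn_slab_translate {F : GaugeConfig d L G → ℝ} {T' T : ℕ}
    (hF : DependsOn F (slabEdges T' T)) {t : ZMod L} (ht1 : T' + 1 ≤ t.val)
    (ht2 : t.val + T ≤ L / 2) :
    DependsOn (fun U => F (torusConfigShift (-(Pi.single (0 : Fin d) t : Site d L)) U))
      ((WilsonOddRP.oPosEdges ∪ WilsonOddRP.oSharedEdges : Finset (Edge d L)) :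
        Set (Edge d L)) := by
  intro U V hUV
  apply hF
  intro e he
  simp only [torusConfigShift_apply]
  apply hUV
  have h0 : (e.1 - -(Pi.single (0 : Fin d) t : Site d L) : Site d L) 0 = e.1 0 + t := by simp
  obtain ⟨hLt, hLe⟩ : t.val < L ∧ (e.1 0).val < L := ⟨ZMod.val_lt t, ZMod.val_lt _⟩
  simp only [Finset.coe_union, Set.mem_union, Finset.mem_coe, WilsonOddRP.mem_oPosEdges,
    WilsonOddRP.mem_oSharedEdges, WilsonOddRP.IsOPosEdge, WilsonOddRP.IsOSharedEdge, h0]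
  left
  rcases he with h | h
  · have hle : (e.1 0).val ≤ T := by split_ifs at h <;> omega
    have hlt : (e.1 0).val + t.val < L := by omega
    rw [ZMod.val_add_of_lt hlt]
    constructor <;> omega
  · have hge : L ≤ (e.1 0).val + t.val := by omega
    have hsum := ZMod.val_add_val_of_le hge
    constructor <;> omega

/-! ### The OS pairing -/

/-- **OS pairing** of two real observables at time separation `s`:
`P_{F,G}(s) := ⟨(F ∘ Θ') · G(· + s e₀)⟩_{L,β} = M_{F∘Θ',G}(s)`.
[folklore: the OS inner product on the lattice, Seiler LNP 159 Ch. 2] -/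
def osPairing (β : ℝ) (F F₂ : GaugeConfig d L G → ℝ) (s : ZMod L) : ℝ :=
  timeTwoPtMixed ρ β (fun U => F U.negReflect) F₂ s

/-- The OS pairing along natural-number separations. -/
def osPairingSeq (β : ℝ) (F F₂ : GaugeConfig d L G → ℝ) (n : ℕ) : ℝ :=
  osPairing ρ β F F₂ (n : ZMod L)

/-- **Symmetry of the OS pairing**: `P_{G,F}(s) = P_{F,G}(s)` (Θ'-invariance of Wilson's measure,
`Θ' τ_s = τ_{-s} Θ'`, translation invariance). [folklore] -/
theorem osPairing_symm (hρ : Continuous ρ) (β : ℝ) (F F₂ : GaugeConfig d L G → ℝ) (s : ZMod L) :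
    osPairing ρ β F₂ F s = osPairing ρ β F F₂ s := by
  unfold osPairing
  rw [timeTwoPtMixed_swap ρ β F₂ (fun U => F U.negReflect) s]
  unfold timeTwoPtMixed wilsonExpectation
  rw [← integral_comp_negReflect_eq ρ hρ β]
  congr 1
  funext U
  have hcomm : torusConfigShift (-(Pi.single (0 : Fin d) s : Site d L)) U.negReflect =
      (torusConfigShift (-(Pi.single (0 : Fin d) (-s) : Site d L)) U).negReflect := by
    rw [Pi.single_neg, neg_neg, negReflect_translate_eq s U]
  simp only [WilsonSiteRP.negReflect_negReflect_config, hcomm]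


/-! ### Reflection positivity ⇒ Gram inequalities for slab translates -/

/-- The positive quadratic form `0 ≤ P_{G,G}(2t' - 1) λ² + 2 P_{F,G}(t + t' - 1) λ + P_{F,F}(2t - 1)`
(link reflection positivity applied to `F(· - t e₀) + λ G(· - t' e₀)`). [folklore] -/
theorem osPairing_quadratic_nonneg (hL : Odd L) (hL3 : 3 ≤ L) (hρ : Continuous ρ) {β : ℝ}
    (hβ : 0 ≤ β) {F F₂ : GaugeConfig d L G → ℝ} (hFm : Measurable F)
    (hFb : ∃ C : ℝ, ∀ U, |F U| ≤ C) {T'₁ T₁ : ℕ} (hFs : DependsOn F (slabEdges T'₁ T₁))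
    (hGm : Measurable F₂) (hGb : ∃ C : ℝ, ∀ U, |F₂ U| ≤ C) {T'₂ T₂ : ℕ}
    (hGs : DependsOn F₂ (slabEdges T'₂ T₂)) {t t' : ZMod L}
    (ht1 : T'₁ + 1 ≤ t.val) (ht2 : t.val + T₁ ≤ L / 2) (ht'1 : T'₂ + 1 ≤ t'.val)
    (ht'2 : t'.val + T₂ ≤ L / 2) (lam : ℝ) :
    0 ≤ osPairing ρ β F₂ F₂ (2 * t' - 1) * (lam * lam) +
      (2 * osPairing ρ β F F₂ (t + t' - 1)) * lam + osPairing ρ β F F (2 * t - 1) := by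
  haveI := isProbabilityMeasure_wilsonMeasure (d := d) (L := L) (G := G) ρ hρ β
  obtain ⟨CF, hCF⟩ := hFb
  obtain ⟨CG, hCG⟩ := hGb
  have hC : ∀ U, |F U| ≤ max CF CG := fun U => (hCF U).trans (le_max_left _ _)
  have hC' : ∀ U, |F₂ U| ≤ max CF CG := fun U => (hCG U).trans (le_max_right _ _)
  have hC0 : 0 ≤ max CF CG := le_trans (abs_nonneg _) (hC (fun _ => 1))
  have hτ : ∀ {Q : GaugeConfig d L G → ℝ}, Measurable Q → ∀ s : ZMod L, Measurable
      fun U : GaugeConfig d L G => Q (torusConfigShift (-(Pi.single (0 : Fin d) s : Site d L)) U) :=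
    fun hQ s => hQ.comp (torusConfigShift _).measurable
  have hτr : ∀ {Q : GaugeConfig d L G → ℝ}, Measurable Q → ∀ s : ZMod L, Measurable fun U =>
      Q (torusConfigShift (-(Pi.single (0 : Fin d) s : Site d L)) U).negReflect :=
    fun hQ s => hQ.comp (WilsonSiteRP.measurable_negReflect.comp (torusConfigShift _).measurable)
  have hI : ∀ {P Q : GaugeConfig d L G → ℝ}, Measurable P → Measurable Q →
      (∀ U, |P U| ≤ max CF CG) → (∀ U, |Q U| ≤ max CF CG) →
      Integrable (fun U => P U * Q U) (wilsonMeasure ρ β) := by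
    intro P Q hPm hQm hP hQ
    refine Integrable.of_bound (hPm.mul hQm).aestronglyMeasurable (max CF CG * max CF CG)
      (ae_of_all _ fun U => ?_)
    rw [Real.norm_eq_abs, abs_mul]
    exact mul_le_mul (hP _) (hQ _) (abs_nonneg _) hC0
  set P : GaugeConfig d L G → ℝ := fun U =>
    F (torusConfigShift (-(Pi.single (0 : Fin d) t : Site d L)) U) +
      lam * F₂ (torusConfigShift (-(Pi.single (0 : Fin d) t' : Site d L)) U) with hP
  have hPm : Measurable P := (hτ hFm t).add ((hτ hGm t').const_mul lam)
  have hPb : ∃ C' : ℝ, ∀ U, |P U| ≤ C' := by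
    refine ⟨max CF CG + |lam| * max CF CG, fun U => ?_⟩
    refine (abs_add_le _ _).trans ?_
    rw [abs_mul]
    gcongr
    exacts [hC _, hC' _]
  have hPdep : DependsOn P
      ((WilsonOddRP.oPosEdges ∪ WilsonOddRP.oSharedEdges : Finset (Edge d L)) :
        Set (Edge d L)) := fun U V hUV => by
    simp only [hP, dependsOn_slab_translate hFs ht1 ht2 hUV,
      dependsOn_slab_translate hGs ht'1 ht'2 hUV]
  have hRP := wilsonExpectation_odd_centred_timeReflect_mul_nonneg ρ hL hL3 hρ hβ hPm hPb
    hPdep 0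
  simp only [sub_zero] at hRP
  have hexp : (fun U => P U.timeReflect * P U) = fun U =>
      F (torusConfigShift (-(Pi.single (0 : Fin d) (1 - t) : Site d L)) U).negReflect *
          F (torusConfigShift (-(Pi.single (0 : Fin d) t : Site d L)) U) +
        lam * (F (torusConfigShift (-(Pi.single (0 : Fin d) (1 - t) : Site d L)) U).negReflect *
          F₂ (torusConfigShift (-(Pi.single (0 : Fin d) t' : Site d L)) U)) +
        lam * (F₂ (torusConfigShift (-(Pi.single (0 : Fin d) (1 - t') : Site d L)) U).negReflect *
          F (torusConfigShift (-(Pi.single (0 : Fin d) t : Site d L)) U)) +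
        lam * lam *
          (F₂ (torusConfigShift (-(Pi.single (0 : Fin d) (1 - t') : Site d L)) U).negReflect *
            F₂ (torusConfigShift (-(Pi.single (0 : Fin d) t' : Site d L)) U)) := by
    funext U
    simp only [hP, translate_timeReflect_eq]
    ring
  rw [hexp] at hRP
  have i1 : Integrable (fun U : GaugeConfig d L G =>
      F (torusConfigShift (-(Pi.single (0 : Fin d) (1 - t) : Site d L)) U).negReflect *
        F (torusConfigShift (-(Pi.single (0 : Fin d) t : Site d L)) U)) (wilsonMeasure ρ β) :=
    hI (hτr hFm (1 - t)) (hτ hFm t) (fun U => hC _) (fun U => hC _)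
  have i2 : Integrable (fun U : GaugeConfig d L G => lam *
      (F (torusConfigShift (-(Pi.single (0 : Fin d) (1 - t) : Site d L)) U).negReflect *
        F₂ (torusConfigShift (-(Pi.single (0 : Fin d) t' : Site d L)) U)))
      (wilsonMeasure ρ β) :=
    (hI (hτr hFm (1 - t)) (hτ hGm t') (fun U => hC _) (fun U => hC' _)).const_mul lam
  have i3 : Integrable (fun U : GaugeConfig d L G => lam *
      (F₂ (torusConfigShift (-(Pi.single (0 : Fin d) (1 - t') : Site d L)) U).negReflect *
        F (torusConfigShift (-(Pi.single (0 : Fin d) t : Site d L)) U)))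
      (wilsonMeasure ρ β) :=
    (hI (hτr hGm (1 - t')) (hτ hFm t) (fun U => hC' _) (fun U => hC _)).const_mul lam
  have i4 : Integrable (fun U : GaugeConfig d L G => lam * lam *
      (F₂ (torusConfigShift (-(Pi.single (0 : Fin d) (1 - t') : Site d L)) U).negReflect *
        F₂ (torusConfigShift (-(Pi.single (0 : Fin d) t' : Site d L)) U)))
      (wilsonMeasure ρ β) :=
    (hI (hτr hGm (1 - t')) (hτ hGm t') (fun U => hC' _) (fun U => hC' _)).const_mul (lam * lam)
  have i12 : Integrable (fun U : GaugeConfig d L G =>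
      F (torusConfigShift (-(Pi.single (0 : Fin d) (1 - t) : Site d L)) U).negReflect *
          F (torusConfigShift (-(Pi.single (0 : Fin d) t : Site d L)) U) +
        lam * (F (torusConfigShift (-(Pi.single (0 : Fin d) (1 - t) : Site d L)) U).negReflect *
          F₂ (torusConfigShift (-(Pi.single (0 : Fin d) t' : Site d L)) U)))
      (wilsonMeasure ρ β) := i1.add i2
  have i123 : Integrable (fun U : GaugeConfig d L G =>
      F (torusConfigShift (-(Pi.single (0 : Fin d) (1 - t) : Site d L)) U).negReflect *
          F (torusConfigShift (-(Pi.single (0 : Fin d) t : Site d L)) U) +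
        lam * (F (torusConfigShift (-(Pi.single (0 : Fin d) (1 - t) : Site d L)) U).negReflect *
          F₂ (torusConfigShift (-(Pi.single (0 : Fin d) t' : Site d L)) U)) +
        lam * (F₂ (torusConfigShift (-(Pi.single (0 : Fin d) (1 - t') : Site d L)) U).negReflect *
          F (torusConfigShift (-(Pi.single (0 : Fin d) t : Site d L)) U)))
      (wilsonMeasure ρ β) := i12.add i3
  unfold wilsonExpectation at hRP
  beta_reduce at hRP
  rw [integral_add i123 i4, integral_add i12 i3, integral_add i1 i2, integral_const_mul,
    integral_const_mul, integral_const_mul] at hRP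
  have e1 := wilsonExpectation_translate_mul_translate₂ ρ β (fun U => F U.negReflect) F (1 - t) t
  have e2 := wilsonExpectation_translate_mul_translate₂ ρ β (fun U => F U.negReflect) F₂
    (1 - t) t'
  have e3 := wilsonExpectation_translate_mul_translate₂ ρ β (fun U => F₂ U.negReflect) F
    (1 - t') t
  have e4 := wilsonExpectation_translate_mul_translate₂ ρ β (fun U => F₂ U.negReflect) F₂
    (1 - t') t'
  beta_reduce at e1 e2 e3 e4
  unfold wilsonExpectation at e1 e2 e3 e4
  rw [e1, e2, e3, e4] at hRP
  have s1 : t - (1 - t) = 2 * t - 1 := by ring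
  have s2 : t' - (1 - t) = t + t' - 1 := by ring
  have s3 : t - (1 - t') = t + t' - 1 := by ring
  have s4 : t' - (1 - t') = 2 * t' - 1 := by ring
  rw [s1, s2, s3, s4] at hRP
  have hsym : timeTwoPtMixed ρ β (fun U => F₂ U.negReflect) F (t + t' - 1) =
      osPairing ρ β F F₂ (t + t' - 1) := osPairing_symm ρ hρ β F F₂ (t + t' - 1)
  rw [hsym] at hRP
  unfold osPairing
  unfold osPairing at hRP
  nlinarith [hRP]

/-- **OS Schwarz inequality for slab observables** (odd torus `L = 2m + 1 ≥ 3`, `β ≥ 0`):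
`P_{F,G}(t + t' - 1)² ≤ P_{F,F}(2t - 1) · P_{G,G}(2t' - 1)` for slab observables and admissible
slices `T'ᵢ + 1 ≤ tᵢ ≤ m - Tᵢ`. [folklore: Schwarz inequality of the OS form, Seiler LNP 159 Ch. 2] -/
theorem osPairing_schwarz (hL : Odd L) (hL3 : 3 ≤ L) (hρ : Continuous ρ) {β : ℝ}
    (hβ : 0 ≤ β) {F F₂ : GaugeConfig d L G → ℝ} (hFm : Measurable F)
    (hFb : ∃ C : ℝ, ∀ U, |F U| ≤ C) {T'₁ T₁ : ℕ} (hFs : DependsOn F (slabEdges T'₁ T₁))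
    (hGm : Measurable F₂) (hGb : ∃ C : ℝ, ∀ U, |F₂ U| ≤ C) {T'₂ T₂ : ℕ}
    (hGs : DependsOn F₂ (slabEdges T'₂ T₂)) {t t' : ZMod L}
    (ht1 : T'₁ + 1 ≤ t.val) (ht2 : t.val + T₁ ≤ L / 2) (ht'1 : T'₂ + 1 ≤ t'.val)
    (ht'2 : t'.val + T₂ ≤ L / 2) :
    (osPairing ρ β F F₂ (t + t' - 1)) ^ 2 ≤
      osPairing ρ β F F (2 * t - 1) * osPairing ρ β F₂ F₂ (2 * t' - 1) := by
  have hquad := osPairing_quadratic_nonneg ρ hL hL3 hρ hβ hFm hFb hFs hGm hGb hGs ht1 ht2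
    ht'1 ht'2
  have hd := discrim_le_zero hquad
  rw [discrim] at hd
  nlinarith [hd]

/-! ### The odd subsequence is log-convex; even terms are sandwiched -/

/-- **Log-convexity of the odd-indexed OS norms**: `P(2n + 1)² ≤ P(2n - 1) · P(2n + 3)` for a
`[-T', T]`-slab observable, `T' + 1 ≤ n`, `n + 2 + T ≤ m` (`L = 2m + 1`). [folklore] -/
theorem osPairingSeq_odd_logConvex {m : ℕ} (hL : L = 2 * m + 1) (hm : 1 ≤ m)
    (hρ : Continuous ρ) {β : ℝ} (hβ : 0 ≤ β) {F : GaugeConfig d L G → ℝ} (hFm : Measurable F)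
    (hFb : ∃ C : ℝ, ∀ U, |F U| ≤ C) {T' T : ℕ} (hFs : DependsOn F (slabEdges T' T)) {n : ℕ}
    (hn1 : T' + 1 ≤ n) (hn2 : n + 2 + T ≤ m) :
    osPairingSeq ρ β F F (2 * n + 1) ^ 2 ≤
      osPairingSeq ρ β F F (2 * n - 1) * osPairingSeq ρ β F F (2 * n + 3) := by
  obtain ⟨hLodd, hL3, hdiv⟩ : Odd L ∧ 3 ≤ L ∧ L / 2 = m := ⟨⟨m, hL⟩, by omega, by omega⟩
  have hvn : ((n : ℕ) : ZMod L).val = n := by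
    rw [ZMod.val_natCast]; exact Nat.mod_eq_of_lt (by omega)
  have hvn2 : ((n + 2 : ℕ) : ZMod L).val = n + 2 := by
    rw [ZMod.val_natCast]; exact Nat.mod_eq_of_lt (by omega)
  have h := osPairing_schwarz ρ hLodd hL3 hρ hβ hFm hFb hFs hFm hFb hFs
    (t := ((n : ℕ) : ZMod L)) (t' := ((n + 2 : ℕ) : ZMod L))
    (by rw [hvn]; omega) (by rw [hvn, hdiv]; omega) (by rw [hvn2]; omega)
    (by rw [hvn2, hdiv]; omega)
  have c1 : ((n : ℕ) : ZMod L) + ((n + 2 : ℕ) : ZMod L) - 1 = ((2 * n + 1 : ℕ) : ZMod L) := by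
    push_cast; ring
  have c2 : (2 : ZMod L) * ((n : ℕ) : ZMod L) - 1 = ((2 * n - 1 : ℕ) : ZMod L) := by
    rw [Nat.cast_sub (by omega)]; push_cast; ring
  have c3 : (2 : ZMod L) * ((n + 2 : ℕ) : ZMod L) - 1 = ((2 * n + 3 : ℕ) : ZMod L) := by
    push_cast; ring
  unfold osPairingSeq
  rw [← c1, ← c2, ← c3]
  exact h

/-- **Even terms are dominated by their odd neighbours**: `P(2n)² ≤ P(2n - 1) · P(2n + 1)` for
`T' + 1 ≤ n`, `n + 1 + T ≤ m`. [folklore] -/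
theorem osPairingSeq_even_sq_le {m : ℕ} (hL : L = 2 * m + 1) (hm : 1 ≤ m)
    (hρ : Continuous ρ) {β : ℝ} (hβ : 0 ≤ β) {F : GaugeConfig d L G → ℝ} (hFm : Measurable F)
    (hFb : ∃ C : ℝ, ∀ U, |F U| ≤ C) {T' T : ℕ} (hFs : DependsOn F (slabEdges T' T)) {n : ℕ}
    (hn1 : T' + 1 ≤ n) (hn2 : n + 1 + T ≤ m) :
    osPairingSeq ρ β F F (2 * n) ^ 2 ≤
      osPairingSeq ρ β F F (2 * n - 1) * osPairingSeq ρ β F F (2 * n + 1) := by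
  obtain ⟨hLodd, hL3, hdiv⟩ : Odd L ∧ 3 ≤ L ∧ L / 2 = m := ⟨⟨m, hL⟩, by omega, by omega⟩
  have hvn : ((n : ℕ) : ZMod L).val = n := by
    rw [ZMod.val_natCast]; exact Nat.mod_eq_of_lt (by omega)
  have hvn1 : ((n + 1 : ℕ) : ZMod L).val = n + 1 := by
    rw [ZMod.val_natCast]; exact Nat.mod_eq_of_lt (by omega)
  have h := osPairing_schwarz ρ hLodd hL3 hρ hβ hFm hFb hFs hFm hFb hFs
    (t := ((n : ℕ) : ZMod L)) (t' := ((n + 1 : ℕ) : ZMod L))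
    (by rw [hvn]; omega) (by rw [hvn, hdiv]; omega) (by rw [hvn1]; omega)
    (by rw [hvn1, hdiv]; omega)
  have c1 : ((n : ℕ) : ZMod L) + ((n + 1 : ℕ) : ZMod L) - 1 = ((2 * n : ℕ) : ZMod L) := by
    push_cast; ring
  have c2 : (2 : ZMod L) * ((n : ℕ) : ZMod L) - 1 = ((2 * n - 1 : ℕ) : ZMod L) := by
    rw [Nat.cast_sub (by omega)]; push_cast; ring
  have c3 : (2 : ZMod L) * ((n + 1 : ℕ) : ZMod L) - 1 = ((2 * n + 1 : ℕ) : ZMod L) := by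
    push_cast; ring
  unfold osPairingSeq
  rw [← c1, ← c2, ← c3]
  exact h

/-- **Nonnegativity along the odd subsequence**: `0 ≤ P(2n + 1)` for `T' ≤ n`, `n + 1 + T ≤ m`.
[folklore] -/
theorem osPairingSeq_odd_nonneg {m : ℕ} (hL : L = 2 * m + 1) (hm : 1 ≤ m)
    (hρ : Continuous ρ) {β : ℝ} (hβ : 0 ≤ β) {F : GaugeConfig d L G → ℝ} (hFm : Measurable F)
    (hFb : ∃ C : ℝ, ∀ U, |F U| ≤ C) {T' T : ℕ} (hFs : DependsOn F (slabEdges T' T)) {n : ℕ}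
    (hn1 : T' ≤ n) (hn2 : n + 1 + T ≤ m) :
    0 ≤ osPairingSeq ρ β F F (2 * n + 1) := by
  obtain ⟨hLodd, hL3, hdiv⟩ : Odd L ∧ 3 ≤ L ∧ L / 2 = m := ⟨⟨m, hL⟩, by omega, by omega⟩
  have hvn1 : ((n + 1 : ℕ) : ZMod L).val = n + 1 := by
    rw [ZMod.val_natCast]; exact Nat.mod_eq_of_lt (by omega)
  have h := osPairing_quadratic_nonneg ρ hLodd hL3 hρ hβ hFm hFb hFs hFm hFb hFs
    (t := ((n + 1 : ℕ) : ZMod L)) (t' := ((n + 1 : ℕ) : ZMod L)) (by rw [hvn1]; omega)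
    (by rw [hvn1, hdiv]; omega) (by rw [hvn1]; omega) (by rw [hvn1, hdiv]; omega) 0
  simp only [mul_zero, add_zero, zero_add] at h
  have c : (2 : ZMod L) * ((n + 1 : ℕ) : ZMod L) - 1 = ((2 * n + 1 : ℕ) : ZMod L) := by
    push_cast; ring
  unfold osPairingSeq
  rw [← c]
  exact h

end Summit.QuantumFields.YangMills.Theorems.SoloBlind

end
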